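import Mathlib.NumberTheory.MulChar.Basic
import Mathlib.NumberTheory.NumberField.Ideal.Basic
import Mathlib.NumberTheory.NumberField.Units.DirichletTheorem
import Literature.NumberTheory.LFunctions.RayClassCharacter
import HarnessLib

/-!
# Power-residue characters modulo a prime ideal are ray class characters

Topic `NumberTheory/LFunctions`.  Theorem-only file (no definition, no named fact), companion of
`RayClassCharacter.lean` (`Literature.NumberTheory.LFunctions.IsRayClassCharacter`, Neukirch VII (6.8)).

Let `K` be a number field, `𝔮` a nonzero prime of `𝓞 K` with residue field `k = 𝓞 K / 𝔮` of
`l = N𝔮` elements, `p ∣ l - 1`, and `χ : k → ℂ` a multiplicative character of `k` (Mathlib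
`MulChar`).  The map `x ↦ χ(x̄)^{(l-1)/p}` is `χ` composed with the **`p`-th power residue symbol
modulo `𝔮`** (`x̄^{(l-1)/p} ∈ μ_p(k)`; Neukirch, *Algebraic Number Theory*, Ch. V §3:
"`(a/𝔭) ≡ a^{(q-1)/n} mod 𝔭`").  Fix `h ≥ 1` with `hh' ≡ 1 (mod p)` and generators `g_v` of the
principal ideals `𝔭_v^h` (e.g. `h` = the class number).  We prove:

* `idealPow_powResidue_span_singleton`: if `χ(ū)^{(l-1)/p} = 1` for every unit `u` of `𝓞 K`, the
  character of ideals with values `ψ(𝔭_v) = χ(ḡ_v)^{(l-1)/p · h'}` on primes satisfies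
  `ψ((b)) = χ(b̄)^{(l-1)/p}` for every `b ∉ 𝔮` — so it only depends on `b mod 𝔮`;
* `isRayClassCharacter_powResidue`: hence `ψ` is a ray class character modulo `𝔮`
  (Neukirch VII (6.8): trivial on the ray `{(b/c) : b ≡ c mod 𝔮}`), with `ψ(𝔭)^p = 1` for
  `𝔭 ≠ 𝔮` (`powResidue_pow_eq_one`);
* `forall_units_powResidue_eq_one`: the unit hypothesis holds as soon as `p` is a prime not
  dividing the number of roots of unity of `K` and `ε^{(l-1)/p} ≡ 1 (mod 𝔮)` for Mathlib's
  fundamental units `ε = fundSystem K i` (Dirichlet's unit theorem).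

This is the classical construction of a character of order `p` and conductor `𝔮` from a prime
`𝔮` that splits completely in `K(ζ_p, E^{1/p})` (Washington, *Cyclotomic Fields*, §15.2, the
auxiliary primes in Thaine's theorem; Rubin, *Euler Systems*, Ch. IV §4 (Kolyvagin primes)).

## References

* J. Neukirch, *Algebraic Number Theory*, Grundlehren 322, Springer 1999, Ch. V §3 (power residue
  symbol), Ch. VII §6 (6.8) (ray class characters). [NeukirchANT1999]
* L. C. Washington, *Introduction to Cyclotomic Fields*, 2nd ed., GTM 83, Springer 1997, §15.2.
  [Washington1997]
-/

noncomputable section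

open IsDedekindDomain NumberField NumberField.Units Finset

namespace Literature.NumberTheory.LFunctions

variable {K : Type*} [Field K] [NumberField K]

/-! ### The residue field of a prime -/

/-- `x̄ ^ (N𝔮 - 1) = 1` in the residue field `𝓞 K / 𝔮` (a field with `N𝔮` elements) for
`x ∉ 𝔮`. [folklore] -/
theorem mk_pow_absNorm_sub_one (𝔮 : HeightOneSpectrum (𝓞 K)) {x : 𝓞 K} (hx : x ∉ 𝔮.asIdeal) :
    Ideal.Quotient.mk 𝔮.asIdeal x ^ (Ideal.absNorm 𝔮.asIdeal - 1) = 1 := by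
  classical
  haveI : 𝔮.asIdeal.IsMaximal := 𝔮.isMaximal
  letI : Field (𝓞 K ⧸ 𝔮.asIdeal) := Ideal.Quotient.field 𝔮.asIdeal
  haveI : Fintype (𝓞 K ⧸ 𝔮.asIdeal) := Fintype.ofFinite _
  have hcard : Fintype.card (𝓞 K ⧸ 𝔮.asIdeal) = Ideal.absNorm 𝔮.asIdeal := by
    rw [← Nat.card_eq_fintype_card, ← Submodule.cardQuot_apply, ← Ideal.absNorm_apply]
  rw [← hcard]
  exact FiniteField.pow_card_sub_one_eq_one _ (mt Ideal.Quotient.eq_zero_iff_mem.mp hx)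

/-- `2 ≤ N𝔮` for a nonzero prime `𝔮`, i.e. `N𝔮 - 1 ≠ 0`. [folklore] -/
theorem absNorm_sub_one_ne_zero (𝔮 : HeightOneSpectrum (𝓞 K)) : Ideal.absNorm 𝔮.asIdeal - 1 ≠ 0 := by
  have h0 : Ideal.absNorm 𝔮.asIdeal ≠ 0 := fun h => 𝔮.ne_bot (Ideal.absNorm_eq_zero_iff.mp h)
  have h1 : Ideal.absNorm 𝔮.asIdeal ≠ 1 := fun h => 𝔮.isPrime.ne_top (Ideal.absNorm_eq_one_iff.mp h)
  omega

/-- A generator of `𝔭_v ^ h` does not lie in a prime `𝔮 ≠ 𝔭_v`. [folklore] -/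
theorem gen_notMem_of_ne {h : ℕ} {G : HeightOneSpectrum (𝓞 K) → 𝓞 K}
    (hG : ∀ v, Ideal.span {G v} = v.asIdeal ^ h) {v 𝔮 : HeightOneSpectrum (𝓞 K)} (hv : v ≠ 𝔮) :
    G v ∉ 𝔮.asIdeal := by
  intro hmem
  haveI : 𝔮.asIdeal.IsPrime := 𝔮.isPrime
  have h1 : v.asIdeal ^ h ≤ 𝔮.asIdeal := by
    rw [← hG v]
    exact (Ideal.span_singleton_le_iff_mem _).mpr hmem
  have h2 : v.asIdeal ≤ 𝔮.asIdeal := Ideal.IsPrime.le_of_pow_le h1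
  exact hv (HeightOneSpectrum.ext (v.isMaximal.eq_of_le 𝔮.isPrime.ne_top h2))

/-! ### The power-residue character of ideals -/

section PowResidue

variable (𝔮 : HeightOneSpectrum (𝓞 K)) {p h h' : ℕ} {G : HeightOneSpectrum (𝓞 K) → 𝓞 K}
  (χ : MulChar (𝓞 K ⧸ 𝔮.asIdeal) ℂ)

/-- `ψ(𝔭_v)^p = 1` for `𝔭_v ≠ 𝔮`, where `ψ(𝔭_v) = χ(ḡ_v)^{(N𝔮-1)/p · h'}` (`ḡ_v ≠ 0` has order
dividing `N𝔮 - 1`). [folklore] -/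
theorem powResidue_pow_eq_one (hpl : p ∣ Ideal.absNorm 𝔮.asIdeal - 1)
    (hG : ∀ v, Ideal.span {G v} = v.asIdeal ^ h) {v : HeightOneSpectrum (𝓞 K)} (hv : v ≠ 𝔮) :
    (χ (Ideal.Quotient.mk 𝔮.asIdeal (G v)) ^ ((Ideal.absNorm 𝔮.asIdeal - 1) / p * h')) ^ p = 1 := by
  rw [← pow_mul, mul_assoc, mul_comm h', ← mul_assoc, Nat.div_mul_cancel hpl, pow_mul, ← map_pow,
    mk_pow_absNorm_sub_one 𝔮 (gen_notMem_of_ne hG hv), map_one, one_pow]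

/-- **The value on principal ideals.**  With `l = N𝔮`, `p ∣ l - 1`, `h h' ≡ 1 (mod p)`,
`(g_v) = 𝔭_v^h`, and `χ(ū)^{(l-1)/p} = 1` for all units `u`: the character of ideals with values
`ψ(𝔭_v) = χ(ḡ_v)^{(l-1)/p · h'}` on primes has `ψ((b)) = χ(b̄)^{(l-1)/p}` for `b ∉ 𝔮`, `b ≠ 0`.
Indeed `(b)^h = ∏ (g_v)^{n_v}` gives `b^h = u ∏ g_v^{n_v}` with a unit `u`, and
`x ↦ χ(x̄)^{(l-1)/p}` kills `u` and `b^{l-1}`. (Neukirch V §3: the power residue symbol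
`(b/𝔮) ≡ b^{(l-1)/p}` depends only on `b mod 𝔮`.) [cite: NeukirchANT1999, Ch. V §3, the power residue symbol] -/
theorem idealPow_powResidue_span_singleton (hpl : p ∣ Ideal.absNorm 𝔮.asIdeal - 1)
    (hh : h * h' % p = 1) (hG : ∀ v, Ideal.span {G v} = v.asIdeal ^ h)
    (hunit : ∀ u : (𝓞 K)ˣ,
      χ (Ideal.Quotient.mk 𝔮.asIdeal u) ^ ((Ideal.absNorm 𝔮.asIdeal - 1) / p) = 1)
    {b : 𝓞 K} (hb : b ≠ 0) (hb𝔮 : b ∉ 𝔮.asIdeal) :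
    idealPow K (fun v => χ (Ideal.Quotient.mk 𝔮.asIdeal (G v)) ^
        ((Ideal.absNorm 𝔮.asIdeal - 1) / p * h')) (Ideal.span {b}) =
      χ (Ideal.Quotient.mk 𝔮.asIdeal b) ^ ((Ideal.absNorm 𝔮.asIdeal - 1) / p) := by
  classical
  set l := Ideal.absNorm 𝔮.asIdeal with hl
  set e := (l - 1) / p with he
  set π := Ideal.Quotient.mk 𝔮.asIdeal with hπ
  have hsb : Ideal.span {b} ≠ 0 := by
    rw [Ideal.zero_eq_bot, ne_eq, Ideal.span_singleton_eq_bot]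
    exact hb
  obtain ⟨n, hn⟩ := exists_finsuppProd_asIdeal_pow_eq hsb
  rw [← hn, idealPow_finsuppProd]
  -- `(b ^ h) = (∏ g_v ^ n_v)`
  have hideal : Ideal.span {b ^ h} = Ideal.span {n.prod fun v k => G v ^ k} := by
    rw [← Ideal.span_singleton_pow, ← hn, Finsupp.prod, Finsupp.prod, ← Finset.prod_pow,
      ← Ideal.prod_span_singleton]
    refine Finset.prod_congr rfl fun v _ => ?_
    rw [← pow_mul, mul_comm, pow_mul, ← hG v, Ideal.span_singleton_pow]
  obtain ⟨u, hu⟩ := Ideal.span_singleton_eq_span_singleton.mp hideal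
  -- apply `x ↦ χ (π x)`
  have h1 : χ (π b) ^ h * χ (π u) = ∏ v ∈ n.support, χ (π (G v)) ^ n v := by
    have h0 := congrArg (fun x => χ (π x)) hu
    simpa only [map_mul, map_pow, map_prod, Finsupp.prod] using h0
  -- raise to the power `e * h'`
  have h2 := congrArg (fun x : ℂ => x ^ (e * h')) h1
  rw [mul_pow, ← pow_mul, pow_mul (χ (π ↑u)), hunit u, one_pow, mul_one, ← Finset.prod_pow] at h2
  have h3 : (n.prod fun v k => (χ (π (G v)) ^ (e * h')) ^ k) =
      ∏ v ∈ n.support, (χ (π (G v)) ^ n v) ^ (e * h') := by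
    rw [Finsupp.prod]
    exact Finset.prod_congr rfl fun v _ => by rw [← pow_mul, ← pow_mul, mul_comm]
  rw [h3, ← h2]
  -- `h * h' = p * c + 1`
  have hhh : h * h' = p * (h * h' / p) + 1 := by
    conv_lhs => rw [← Nat.div_add_mod (h * h') p, hh]
  obtain ⟨c, hc⟩ : ∃ c, h * h' = p * c + 1 := ⟨_, hhh⟩
  have hpow : π b ^ (l - 1) = 1 := mk_pow_absNorm_sub_one 𝔮 hb𝔮
  calc χ (π b) ^ (h * (e * h')) = χ (π b) ^ (e * (h * h')) := by ring_nf
    _ = χ (π b) ^ ((l - 1) * c + e) := by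
      rw [hc, mul_add, mul_one, ← mul_assoc, he, Nat.div_mul_cancel hpl]
    _ = χ (π b) ^ e := by rw [pow_add, pow_mul, ← map_pow, hpow, map_one, one_pow, one_mul]

/-- **Power-residue characters modulo `𝔮` are ray class characters modulo `𝔮`** (Neukirch VII
(6.8)): under the hypotheses of `idealPow_powResidue_span_singleton`, `𝔭_v ↦ χ(ḡ_v)^{(N𝔮-1)/p · h'}`
is a Dirichlet character `mod 𝔮` — its values on `𝔭 ≠ 𝔮` are roots of unity, and
`ψ((b)) = χ(b̄)^{(N𝔮-1)/p} = ψ((c))` whenever `b ≡ c (mod 𝔮)` with `c` prime to `𝔮`.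
[cite: NeukirchANT1999, Ch. VII §6 Def. (6.8)] -/
theorem isRayClassCharacter_powResidue (hpl : p ∣ Ideal.absNorm 𝔮.asIdeal - 1)
    (hh : h * h' % p = 1) (hG : ∀ v, Ideal.span {G v} = v.asIdeal ^ h)
    (hunit : ∀ u : (𝓞 K)ˣ,
      χ (Ideal.Quotient.mk 𝔮.asIdeal u) ^ ((Ideal.absNorm 𝔮.asIdeal - 1) / p) = 1) :
    IsRayClassCharacter 𝔮.asIdeal (fun v => χ (Ideal.Quotient.mk 𝔮.asIdeal (G v)) ^
      ((Ideal.absNorm 𝔮.asIdeal - 1) / p * h')) where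
  norm_eq_one v hv := by
    have hv' : v ≠ 𝔮 := fun h => hv (h ▸ le_rfl)
    have h1 : χ (Ideal.Quotient.mk 𝔮.asIdeal (G v)) ^ (Ideal.absNorm 𝔮.asIdeal - 1) = 1 := by
      rw [← map_pow, mk_pow_absNorm_sub_one 𝔮 (gen_notMem_of_ne hG hv'), map_one]
    rw [norm_pow, Complex.norm_eq_one_of_pow_eq_one h1 (absNorm_sub_one_ne_zero 𝔮), one_pow]
  idealPow_span_eq b c hb hc hcop hbc _ := by
    have hc𝔮 : c ∉ 𝔮.asIdeal := fun hmem =>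
      (isCoprime_iff_forall_not_le 𝔮.ne_bot).mp hcop 𝔮 le_rfl
        ((Ideal.span_singleton_le_iff_mem _).mpr hmem)
    have hb𝔮 : b ∉ 𝔮.asIdeal := fun hmem => hc𝔮 (by simpa using 𝔮.asIdeal.sub_mem hmem hbc)
    rw [idealPow_powResidue_span_singleton 𝔮 χ hpl hh hG hunit hb hb𝔮,
      idealPow_powResidue_span_singleton 𝔮 χ hpl hh hG hunit hc hc𝔮, Ideal.Quotient.eq.mpr hbc]

end PowResidue

/-! ### Killing the units -/

/-- **Criterion for `χ(ū)^{(N𝔮-1)/p} = 1` on all units.**  If `p` is a prime with `p ∣ N𝔮 - 1`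
not dividing the order `w_K` of the group of roots of unity of `K`, and
`ε_i^{(N𝔮-1)/p} ≡ 1 (mod 𝔮)` for the fundamental units `ε_i = fundSystem K i`, then
`χ(ū)^{(N𝔮-1)/p} = 1` for every unit `u`: by Dirichlet's unit theorem
(`NumberField.Units.exist_unique_eq_mul_prod`) `u = ζ ∏ ε_i^{a_i}` with `ζ` a root of unity, and
`ζ` is a `p`-th power of a unit since `p ∤ w_K`, while `x ↦ χ(x̄)^{(N𝔮-1)/p}` kills `p`-th powers
(`x̄^{N𝔮-1} = 1`). [folklore] -/
theorem forall_units_powResidue_eq_one (𝔮 : HeightOneSpectrum (𝓞 K)) {p : ℕ} (hp : p.Prime)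
    (hpl : p ∣ Ideal.absNorm 𝔮.asIdeal - 1) (hpt : ¬ p ∣ torsionOrder K)
    (χ : MulChar (𝓞 K ⧸ 𝔮.asIdeal) ℂ)
    (hfund : ∀ i, ((fundSystem K i : (𝓞 K)ˣ) : 𝓞 K) ^ ((Ideal.absNorm 𝔮.asIdeal - 1) / p) - 1 ∈
      𝔮.asIdeal) :
    ∀ u : (𝓞 K)ˣ, χ (Ideal.Quotient.mk 𝔮.asIdeal u) ^ ((Ideal.absNorm 𝔮.asIdeal - 1) / p) = 1 := by
  classical
  set e := (Ideal.absNorm 𝔮.asIdeal - 1) / p with he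
  set π := Ideal.Quotient.mk 𝔮.asIdeal with hπ
  -- the homomorphism `u ↦ χ(ū)^e : (𝓞 K)ˣ → ℂˣ`
  set Θ₀ : (𝓞 K)ˣ →* ℂ := ((powMonoidHom e).comp χ.toMonoidHom).comp
    ((Ideal.Quotient.mk 𝔮.asIdeal).toMonoidHom.comp (Units.coeHom (𝓞 K))) with hΘ₀
  set Θ : (𝓞 K)ˣ →* ℂˣ := Θ₀.toHomUnits with hΘdef
  have hΘ : ∀ u : (𝓞 K)ˣ, u ∈ Θ.ker ↔ χ (π u) ^ e = 1 := fun u => by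
    rw [MonoidHom.mem_ker, ← Units.val_eq_one, hΘdef, MonoidHom.coe_toHomUnits]
    rfl
  have hunit𝔮 : ∀ u : (𝓞 K)ˣ, (u : 𝓞 K) ∉ 𝔮.asIdeal := fun u hu =>
    𝔮.isPrime.ne_top (Ideal.eq_top_of_isUnit_mem _ hu u.isUnit)
  -- `p`-th powers are killed
  have hp_mem : ∀ u : (𝓞 K)ˣ, u ^ p ∈ Θ.ker := fun u => by
    rw [hΘ, Units.val_pow_eq_pow_val, map_pow, map_pow, ← pow_mul, Nat.mul_comm p e, he,
      Nat.div_mul_cancel hpl, ← map_pow, mk_pow_absNorm_sub_one 𝔮 (hunit𝔮 u), map_one]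
  -- the fundamental units are killed
  have hf_mem : ∀ i, fundSystem K i ∈ Θ.ker := fun i => by
    rw [hΘ, ← map_pow, ← map_pow]
    have h1 : π (((fundSystem K i : (𝓞 K)ˣ) : 𝓞 K) ^ e) = π 1 := Ideal.Quotient.eq.mpr (hfund i)
    rw [h1, map_one, map_one]
  -- the roots of unity are killed
  have ht_mem : ∀ ζ : (𝓞 K)ˣ, ζ ∈ torsion K → ζ ∈ Θ.ker := fun ζ hζ => by
    have hord : orderOf ζ ∣ torsionOrder K := by
      have h1 := orderOf_dvd_natCard (⟨ζ, hζ⟩ : torsion K)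
      rwa [Subgroup.orderOf_mk] at h1
    have hcop : p.Coprime (orderOf ζ) :=
      (Nat.Prime.coprime_iff_not_dvd hp).mpr fun hd => hpt (hd.trans hord)
    obtain ⟨m, hm⟩ := exists_pow_eq_self_of_coprime hcop
    rw [← hm, ← pow_mul, mul_comm, pow_mul]
    exact hp_mem _
  -- every unit is `ζ ∏ ε_i ^ a_i`
  intro u
  rw [← hΘ]
  obtain ⟨⟨ζ, a⟩, hu, -⟩ := exist_unique_eq_mul_prod K u
  rw [hu]
  exact mul_mem (ht_mem _ ζ.2) (prod_mem fun i _ => Subgroup.zpow_mem _ (hf_mem i) _)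

end Literature.NumberTheory.LFunctions

end
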